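import Literature.IUT.HodgeTheaters.ThetaPMEllHodgeTheaters
import Literature.IUT.HodgeTheaters.PMBaseBridgePropsProofs5
import Literature.IUT.HodgeTheaters.PMBaseBridgePropsProofs8

/-!
# Proofs over [IUTchI] Cor 6.12 (ii) / Rmk 6.12.1: the gluing torsor for Θ^±- and Θ^{ell}-bridges

Mochizuki, *Inter-universal Teichmüller theory I*, §6, Corollary 6.12 (ii) p. 173, Remark 6.12.1 p. 174,
kurims manuscript (May 2020). PROOF-ONLY companion (theorems, no definitions) to abc-iut-L5-t4's
`ThetaPMEllHodgeTheaters.lean`, by the L5 discharge seat abc-iut-L5-t13.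

* **Cor 6.12 (ii) — PROVED unconditionally** (`FKit.ThetaPMBridge.gluingTorsor`): abc-iut-L5-t4 renders
  Cor 6.12 (ii) (the gluing torsor over `𝔽_l^{⋊±} × ({±1}^𝕍)` for a Θ^±-bridge and a Θ^{ell}-bridge) as the
  `𝒟`-level `GluingTorsor` of the underlying base bridges (Cor 5.3 (ii)) and proves it (`FKit.gluingTorsorF`)
  from the HYPOTHESIS that Prop 6.6 (iv) holds; here that hypothesis is discharged by
  `DThetaPMBridge.gluingTorsor` (`PMBaseBridgePropsProofs8`), so the conclusion holds outright.
* **Rmk 6.12.1 — PROVED conditionally** (`FKit.functorialDynamicsPM_of_equivariant`): the named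
  statement `FunctorialDynamicsPM` (Prop 6.8 (i)'s `𝔽_l^{⋊±}`-symmetry for the associated base theater
  of every Θ^{±ell}-Hodge theater), given the negative equivariance of Example 6.3 (ii)
  (`DThetaPMEllHT.ellBridgeSymmetry_of_equivariant`, `PMBaseBridgePropsProofs5`).
Record only; [claim: Mochizuki2012, status: disputed]; nothing here takes a side on any disputed step.
-/

namespace Literature.IUT.HodgeTheaters

open CategoryTheory

universe u

namespace PMBaseKit

variable {l : ℕ} {K : PMBaseKit.{u} l} {M : K.MultKit} {FK : K.FKit M}

namespace FKit

/-- **[IUTchI] Cor 6.12 (ii) — PROVED unconditionally**: the gluing torsor statement for the underlying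
base bridges of every Θ^±-bridge and Θ^{ell}-bridge (the conclusion of abc-iut-L5-t4's `FKit.gluingTorsorF`
with its Prop 6.6 (iv) hypothesis discharged; via Cor 5.3 (ii) + Prop 6.6 (iv), as printed).
[claim: Mochizuki2012, status: disputed] -/
theorem ThetaPMBridge.gluingTorsor (B : FK.ThetaPMBridge) (B' : FK.ThetaEllBridge) :
    GluingTorsor B.dBridge B'.dBridge :=
  FKit.gluingTorsorF FK (fun B₀ B₀' => DThetaPMBridge.gluingTorsor B₀ B₀') B B'

/-- **[IUTchI] Rmk 6.12.1 — PROVED conditionally** (equivariance of Example 6.3 (ii) for the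
negative elements of `𝔽_l^{⋊±}`): the named statement `FunctorialDynamicsPM`.
[claim: Mochizuki2012, status: disputed] -/
theorem functorialDynamicsPM_of_equivariant
    (hE : ∀ γ : FlPM l, γ.IsNegative → Ex63.Equivariant K γ) : FunctorialDynamicsPM FK :=
  fun H => DThetaPMEllHT.ellBridgeSymmetry_of_equivariant hE H.dHT

end FKit

end PMBaseKit

end Literature.IUT.HodgeTheaters
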